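import Summits.BirchSwinnertonDyer.Rank1Residual.X11b.AnticyclotomicStrictDescent
import Literature.NumberTheory.EllipticCurves.IwasawaSelmerControlCokerProofs
import HarnessLib

/-!
# X11b, route R1 — the COKERNEL of the control map `s : Sel_𝔭^Σ(K, E[p^∞]) → Sel_𝔭^Σ(K_∞, E[p^∞])^Γ`
# reduces to the local kernels AWAY from `p` outside `Σ` (Lemma 3.2 + strict descent, on tree objects)

HONEST FRAMING (cell `b2b-bsdres`, run/shared/lean/b2b/bsd-rank1-residual/, verbatim in every
file): the goal of the cell is to DELETE the COMBINATION-SHAPED residual classes of the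
Birch–Swinnerton-Dyer formula for ALL analytic-rank `≤ 1` elliptic curves over `ℚ` — "full BSD
formula for every rank `≤ 1` curve in class `C`" assembled STRICTLY from published theorems — so
that the rank-`≤ 1` remainder becomes exactly the CONSTRUCTION-SHAPED classes, which are TYPED
(missing-input `Prop`s), NOT attempted. This is not "finishing BSD". Sub-cell
`b2b-bsdres-multr1-p1` (X11b, route R1 = Castella 2018 Thm. A re-proved along the author's
erratum); a RESEARCH ROUTE; no claim beyond the stated class; X11b stays CONSTRUCTION-SHAPED;
nothing here changes a label; no named fact is minted (proved theorems only; no `sorry`).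

## Why this file

Gen 10 so far: the control map `s` (`AnticyclotomicControlMap.controlMap`) is INJECTIVE on route R1
(Lemma 3.1 with `E(K_∞)[p^∞] = 0`), and Castella's STRICT condition at `𝔭` descends from `K_∞` to
`K` under the erratum's hypothesis (iv) (`AnticyclotomicStrictDescent`). This file adds Greenberg's
Lemma 3.2 — `coker (H¹(K, M) → H¹(K_∞, M)^Γ) = 0`, PROVED in the tree for every discrete
`p`-primary `Γ_K`-module and every `ℤ_p`-extension (`ZpExtension.mem_range_resOfLe_of_conjH1_eq`,
the cocycle-level `cd_p(ℤ_p) = 1` argument) — read at the layer `n = 0` (`κ⁻¹(p⁰ℤ_p) = Γ_K`), and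
assembles the snake-lemma conclusion for Castella's Selmer groups ON THE TREE'S OBJECTS:

* `exists_resOfLe_top_eq_of_conj_eq` — every class of `H¹(K_∞, M)` fixed by `conj_γ` (`γ` a
  topological generator) is `res_{K→K_∞} c` for some `c ∈ H¹(⊤, M) = H¹(K, M)`;
* `mem_selmerAcBase_iff_away_inf` — for such a `c` with `res c ∈ Sel_𝔭^Σ(K_∞, M)` and
  `M^{D_𝔭 ⊓ ker κ} = 0`: `c ∈ Sel_𝔭^Σ(K, M)` IFF `c` satisfies the local conditions AWAY from `p`
  outside `Σ` and at the infinite places — the strict condition at `𝔭` is automatic (strict descent)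
  and there is no condition above the other primes over `p`;
* **`controlMap_surjective_of_local_descent`** / **`controlMap_bijective_of_local_descent`** — if
  the away-conditions (at the finite `v ∉ Σ`, `v ∤ p`) and the infinite conditions DESCEND from
  `K_∞` to `K` (hypotheses `hS`, `hinf`, pointwise on classes), then `s` is surjective, and bijective
  when moreover `H¹(K, M) ↪ H¹(K_∞, M)`: **`Sel_𝔭^Σ(K, E[p^∞]) ≅ Sel_𝔭^Σ(K_∞, E[p^∞])^Γ`**;
* the descent hypotheses are DISCHARGED where they are trivial: at a place `v` (resp. `w`) whose
  decomposition group lies in `ker κ` — `v` splits completely in `K_∞/K` — the condition over `K_∞`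
  at the chosen place IS the condition over `K` (`resOfLe_mem_awayKer_iff_of_decomp_le`,
  `resOfLe_mem_infKer_iff_of_decompInf_le`);
* ROUTE R1 (`ChainLocus.controlMap_bijective_of_local_descent`): on route R1's population, for an
  arbitrary number field `K`, degree-one `𝔭 ∣ p`, `ℤ_p`-extension `κ`, topological generator `γ`:
  `s` is BIJECTIVE as soon as the away/inf conditions descend — the only inputs of the control
  theorem NOT discharged on tree objects are thus the local kernels
  `ker (H¹(K_v, E[p^∞]) → H¹(K_{∞,w}, E[p^∞]))` at the finite `v ∉ Σ ∪ {𝔭, 𝔭̄}` not split in `K_∞`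
  (Greenberg's Lemma 3.3: trivial at good `v`, the `p`-part of `c_v` at bad `v` — Castella's (5.2),
  `Σ ⊇ {w ∣ N⁺}`) and at the infinite places (vacuous for `K` imaginary quadratic, `K_w = ℂ`).

What is NOT claimed: the vanishing/size of those remaining local kernels; `#Sel_𝔭(K, E[p^∞])` in
terms of `Ш(E/K)[p^∞]` and `log_ω P` (JSW17 §3.3.5, Poitou–Tate); `Sel_Γ = 0`. The control theorem
stays the PUB-shaped input `R1ControlOnTreeAt`.

References: [GreenbergLNM1716] §3, Lemmas 3.1–3.3 and the snake-lemma paragraph (pp. 85–90);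
[JetchevSkinnerWan2017] §3.3 (arXiv:1512.06894; shape only); [Castella2018] Def. 2.2, Thm. 2.3
(arXiv:1704.06608 p. 5); [SerreGaloisCohomology1997] I.§2.6 (b), I.§3.4.
-/

noncomputable section

open scoped Classical

open NumberField IsDedekindDomain Field
open Literature.NumberTheory.EllipticCurves Literature.NumberTheory.EllipticCurves.GreenbergSelmer
open Literature.NumberTheory.GaloisRepresentations

universe u

namespace Summit.BirchSwinnertonDyer.Rank1Residual.X11b.AcSelmer

variable {K : Type u} [Field K] [NumberField K] {p : ℕ} [Fact p.Prime] (κ : ZpExtension K p)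

/-! ## Lemma 3.2 at the layer `n = 0`: `H¹(K, M) → H¹(K_∞, M)^Γ` is onto -/

section Lemma32

variable {M : Type u} [AddCommGroup M] [DistribMulAction (absoluteGaloisGroup K) M]
  [TopologicalSpace M] [DiscreteTopology M]

omit [NumberField K] in
/-- `⊤ ≤ κ⁻¹(p⁰ ℤ_p)` (the layer-`0` subgroup is all of `Γ_K`, `ZpExtension.layerSubgroup_zero`).
[cite: Washington1997, §13.1] -/
theorem top_le_layerSubgroup_zero : (⊤ : Subgroup (absoluteGaloisGroup K)) ≤ κ.layerSubgroup 0 := by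
  rw [κ.layerSubgroup_zero]

/-- **Greenberg's Lemma 3.2 at `n = 0`, for any discrete `p`-primary `Γ_K`-module** (tree
`ZpExtension.mem_range_resOfLe_of_conjH1_eq`, the `cd_p(ℤ_p) = 1` argument on cocycles): a class
`x ∈ H¹(K_∞, M)` fixed by `conj_γ` for a topological generator `γ` of `Gal(K_∞/K)` is the restriction
of a class `c ∈ H¹(⊤, M) = H¹(K, M)` — "`coker(h_0) = 0`". (The tree's statement lands in
`H¹(κ⁻¹(p⁰ℤ_p), M)`; we move it to `H¹(⊤, M)` along `⊤ = κ⁻¹(p⁰ℤ_p)`.)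
[cite: GreenbergLNM1716, §3 Lemma 3.2 (p. 86)] [cite: SerreGaloisCohomology1997, I.§3.4] -/
theorem exists_resOfLe_top_eq_of_conj_eq {γ : absoluteGaloisGroup K} (hγ : κ.IsTopGenerator γ)
    (hcont : ∀ m : M, Continuous fun g : absoluteGaloisGroup K ↦ g • m)
    (hprim : ∀ m : M, ∃ k : ℕ, p ^ k • m = 0) (x : subgroupH1 κ.kerSubgroup M)
    (hx : conjH1 κ.kerSubgroup M γ x = x) :
    ∃ c : subgroupH1 (⊤ : Subgroup (absoluteGaloisGroup K)) M,
      resOfLe M (le_top : κ.kerSubgroup ≤ ⊤) c = x := by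
  have hx' : conjH1 κ.kerSubgroup M (γ ^ p ^ 0) x = x := by rwa [pow_zero, pow_one]
  obtain ⟨b, hb⟩ := ZpExtension.mem_range_resOfLe_of_conjH1_eq κ hγ 0 hcont hprim x hx'
  refine ⟨resOfLe M (top_le_layerSubgroup_zero κ) b, ?_⟩
  rw [← AddMonoidHom.comp_apply, resOfLe_comp_holds]
  exact hb

end Lemma32

/-! ## Where the local conditions descend trivially: places split completely in `K_∞` -/

section Split

variable {M : Type u} [AddCommGroup M] [DistribMulAction (absoluteGaloisGroup K) M]
  [TopologicalSpace M] [DiscreteTopology M]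
variable {H : Subgroup (absoluteGaloisGroup K)}

/-- **At a finite place whose decomposition group lies in `H`** (`v` splits completely in `K̄^H`,
e.g. `H = ker κ` and `v` totally split in `K_∞/K`): local triviality at the chosen place above `v`
over `K̄^H` after restriction IFF local triviality at `v` over `K` (`H ⊓ D_v = D_v = ⊤ ⊓ D_v`, so the
two restrictions to `D_v` agree up to the injective `res` between equal subgroups,
`resOfLe_injective_of_ge`). [cite: GreenbergLNM1716, §3 p. 87 (primes that split completely)] -/
theorem resOfLe_mem_awayKer_iff_of_decomp_le (v : HeightOneSpectrum (𝓞 K)) (hD : decomp v ≤ H)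
    (c : subgroupH1 (⊤ : Subgroup (absoluteGaloisGroup K)) M) :
    resOfLe M (le_top : H ≤ ⊤) c ∈ awayKer H M v ↔ c ∈ awayKer ⊤ M v := by
  refine ⟨fun hc ↦ ?_, resOfLe_mem_awayKer le_top v⟩
  rw [awayKer, AddMonoidHom.mem_ker] at hc ⊢
  have h1 : H ⊓ decomp v ≤ ⊤ ⊓ decomp v := inf_le_inf_right _ le_top
  have h2 : ⊤ ⊓ decomp v ≤ H ⊓ decomp v := fun g hg ↦
    Subgroup.mem_inf.mpr ⟨hD (Subgroup.mem_inf.mp hg).2, (Subgroup.mem_inf.mp hg).2⟩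
  rw [← AddMonoidHom.comp_apply, resOfLe_comp_holds] at hc
  have e : resOfLe M ((inf_le_left : H ⊓ decomp v ≤ H).trans (le_top : H ≤ ⊤)) =
      (resOfLe M h1).comp (resOfLe M (inf_le_left : ⊤ ⊓ decomp v ≤ ⊤)) :=
    (resOfLe_comp_holds h1 _).symm
  rw [e, AddMonoidHom.comp_apply] at hc
  exact (injective_iff_map_eq_zero _).mp (resOfLe_injective_of_ge M h1 h2) _ hc

omit [NumberField K] in
/-- The same at an infinite place whose decomposition group lies in `H` (e.g. a complex place, or
any infinite place when `K̄^H/K` is unramified at infinity, as every `ℤ_p`-extension is for odd `p`).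
[cite: GreenbergLNM1716, §3 p. 87 (archimedean primes split completely)] -/
theorem resOfLe_mem_infKer_iff_of_decompInf_le (w : InfinitePlace K) (hD : decompInf w ≤ H)
    (c : subgroupH1 (⊤ : Subgroup (absoluteGaloisGroup K)) M) :
    resOfLe M (le_top : H ≤ ⊤) c ∈ infKer H M w ↔ c ∈ infKer ⊤ M w := by
  refine ⟨fun hc ↦ ?_, resOfLe_mem_infKer le_top w⟩
  rw [infKer, AddMonoidHom.mem_ker] at hc ⊢
  have h1 : H ⊓ decompInf w ≤ ⊤ ⊓ decompInf w := inf_le_inf_right _ le_top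
  have h2 : ⊤ ⊓ decompInf w ≤ H ⊓ decompInf w := fun g hg ↦
    Subgroup.mem_inf.mpr ⟨hD (Subgroup.mem_inf.mp hg).2, (Subgroup.mem_inf.mp hg).2⟩
  rw [← AddMonoidHom.comp_apply, resOfLe_comp_holds] at hc
  have e : resOfLe M ((inf_le_left : H ⊓ decompInf w ≤ H).trans (le_top : H ≤ ⊤)) =
      (resOfLe M h1).comp (resOfLe M (inf_le_left : ⊤ ⊓ decompInf w ≤ ⊤)) :=
    (resOfLe_comp_holds h1 _).symm
  rw [e, AddMonoidHom.comp_apply] at hc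
  exact (injective_iff_map_eq_zero _).mp (resOfLe_injective_of_ge M h1 h2) _ hc

end Split

/-! ## The image of `s`: only the away and infinite conditions matter -/

section Image

variable {M : Type u} [AddCommGroup M] [DistribMulAction (absoluteGaloisGroup K) M]
  [TopologicalSpace M] [DiscreteTopology M] (𝔭 : HeightOneSpectrum (𝓞 K))
  (S : Set (HeightOneSpectrum (𝓞 K)))

/-- **Which lifts lie in `Sel_𝔭^Σ(K, M)`.** For `c ∈ H¹(⊤, M)` whose restriction to `K_∞` lies in
`Sel_𝔭^Σ(K_∞, M)`, and `M` with no nonzero element fixed by `D_𝔭 ⊓ ker κ`: `c ∈ Sel_𝔭^Σ(K, M)` IFF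
`c` satisfies the AWAY conditions (finite `v ∉ Σ`, `v ∤ p`) and the INFINITE conditions over `K` —
the strict condition at `𝔭` descends (`mem_strictKer_top_of_resOfLe_mem`) and `conj_σ c = c` on
`H¹(⊤, M)`. [cite: GreenbergLNM1716, §3 pp. 85–86 (`ker g_n`)] [cite: JetchevSkinnerWan2017, §3.3 (control; shape only)] -/
theorem mem_selmerAcBase_iff_away_inf
    (hcont : ∀ m : M, Continuous fun g : absoluteGaloisGroup K ↦ g • m)
    (h0 : ∀ m : M, (∀ x ∈ decomp 𝔭 ⊓ κ.kerSubgroup, x • m = m) → m = 0)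
    {c : subgroupH1 (⊤ : Subgroup (absoluteGaloisGroup K)) M}
    (hc : resOfLe M (le_top : κ.kerSubgroup ≤ ⊤) c ∈ selmerOver κ.kerSubgroup M p 𝔭 S) :
    c ∈ selmerOver ⊤ M p 𝔭 S ↔
      (∀ v : HeightOneSpectrum (𝓞 K), ((p : ℕ) : 𝓞 K) ∉ v.asIdeal → v ∉ S → c ∈ awayKer ⊤ M v) ∧
        ∀ w : InfinitePlace K, c ∈ infKer ⊤ M w := by
  have hconj : ∀ σ : absoluteGaloisGroup K, conjH1 ⊤ M σ c = c := fun σ ↦ by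
    rw [conjH1_of_mem_holds ⊤ M (Subgroup.mem_top σ), AddMonoidHom.id_apply]
  rw [mem_selmerOver_iff]
  simp only [hconj]
  constructor
  · rintro ⟨ha, hi, -⟩
    exact ⟨fun v hv hvS ↦ ha v hv hvS 1, fun w ↦ hi w 1⟩
  · rintro ⟨ha, hi⟩
    refine ⟨fun v hv hvS _ ↦ ha v hv hvS, fun w _ ↦ hi w, fun _ ↦ ?_⟩
    have hstrict := ((mem_selmerOver_iff _).mp hc).2.2 1
    rw [conjH1_one_holds, AddMonoidHom.id_apply] at hstrict
    exact mem_strictKer_top_of_resOfLe_mem p κ 𝔭 hcont h0 hstrict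

end Image

/-! ## Surjectivity and bijectivity of `s` modulo local descent -/

section Control

variable (W : WeierstrassCurve K) (p) (𝔭 : HeightOneSpectrum (𝓞 K))
  (S : Set (HeightOneSpectrum (𝓞 K)))

/-- **`s` is SURJECTIVE modulo local descent.** For an elliptic curve `E/K`, a `ℤ_p`-extension `κ`
with topological generator `γ`, `𝔭`, `Σ`: assume `E(K̄)[p^∞]^{D_𝔭 ⊓ ker κ} = 0` (gen 10, from (iv))
and that for every class `c ∈ H¹(K, E[p^∞])` whose restriction lies in `Sel_𝔭^Σ(K_∞, E[p^∞])`, the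
away conditions (`hS`) and the infinite conditions (`hinf`) hold for `c` over `K`. Then every
`γ`-invariant class of `Sel_𝔭^Σ(K_∞, E[p^∞])` is in the image of `s` (Lemma 3.2 gives a lift,
`mem_selmerAcBase_iff_away_inf` puts it in `Sel_𝔭^Σ(K, E[p^∞])`).
[cite: GreenbergLNM1716, §3 p. 90 (Lemmas 3.1, 3.2, 3.5 ⟹ Thm. 1.2)] [cite: JetchevSkinnerWan2017, §3.3 (control; shape only)] -/
theorem controlMap_surjective_of_local_descent {γ : absoluteGaloisGroup K} (hγ : κ.IsTopGenerator γ)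
    (h0 : FixedPoints.addSubgroup ↥(decomp 𝔭 ⊓ κ.kerSubgroup) (W.geomPrimaryTorsion p) = ⊥)
    (hS : ∀ c : W.subgroupH1 p (⊤ : Subgroup (absoluteGaloisGroup K)),
      W.resOfLe p (le_top : κ.kerSubgroup ≤ ⊤) c ∈ selmerAc W p κ 𝔭 S →
        ∀ v : HeightOneSpectrum (𝓞 K), ((p : ℕ) : 𝓞 K) ∉ v.asIdeal → v ∉ S →
          c ∈ awayKer ⊤ (W.geomPrimaryTorsion p) v)
    (hinf : ∀ c : W.subgroupH1 p (⊤ : Subgroup (absoluteGaloisGroup K)),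
      W.resOfLe p (le_top : κ.kerSubgroup ≤ ⊤) c ∈ selmerAc W p κ 𝔭 S →
        ∀ w : InfinitePlace K, c ∈ infKer ⊤ (W.geomPrimaryTorsion p) w) :
    Function.Surjective (controlMap W p κ 𝔭 S γ) := by
  intro x
  have hprim : ∀ m : W.geomPrimaryTorsion p, ∃ k : ℕ, p ^ k • m = 0 := fun m ↦ by
    obtain ⟨k, hk⟩ := m.2
    exact ⟨k, Subtype.ext (by rw [AddSubgroupClass.coe_nsmul, hk, ZeroMemClass.coe_zero])⟩
  have hx : W.conjH1 p κ.kerSubgroup γ ((x : selmerAc W p κ 𝔭 S) : W.subgroupH1 p κ.kerSubgroup) =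
      ((x : selmerAc W p κ 𝔭 S) : W.subgroupH1 p κ.kerSubgroup) := by
    have h := (IwasawaDual.mem_endInvariants_iff _ _).mp x.2
    rw [IwasawaDual.End_sub_apply, AddMonoid.End.one_apply, sub_eq_zero] at h
    exact congrArg (fun y : selmerAc W p κ 𝔭 S ↦ (y : W.subgroupH1 p κ.kerSubgroup)) h
  obtain ⟨c, hc⟩ := exists_resOfLe_top_eq_of_conj_eq κ hγ (W.continuous_smul_geomPrimaryTorsion p)
    hprim _ hx
  have hcSel : W.resOfLe p (le_top : κ.kerSubgroup ≤ ⊤) c ∈ selmerAc W p κ 𝔭 S := by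
    rw [hc]; exact (x : selmerAc W p κ 𝔭 S).2
  have h0' : ∀ m : W.geomPrimaryTorsion p, (∀ y ∈ decomp 𝔭 ⊓ κ.kerSubgroup, y • m = m) → m = 0 :=
    fun m hm ↦ by
      have : m ∈ FixedPoints.addSubgroup ↥(decomp 𝔭 ⊓ κ.kerSubgroup) (W.geomPrimaryTorsion p) :=
        fun y ↦ hm y y.2
      rwa [h0, AddSubgroup.mem_bot] at this
  have hcBase : c ∈ selmerAcBase W p 𝔭 S :=
    (mem_selmerAcBase_iff_away_inf κ 𝔭 S (W.continuous_smul_geomPrimaryTorsion p) h0' hcSel).mpr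
      ⟨hS c hcSel, hinf c hcSel⟩
  refine ⟨⟨c, hcBase⟩, Subtype.ext (Subtype.ext ?_)⟩
  rw [coe_controlMap_apply]
  exact hc

/-- **`s` is BIJECTIVE modulo local descent**: `Sel_𝔭^Σ(K, E[p^∞]) ≅ Sel_𝔭^Σ(K_∞, E[p^∞])^γ` when,
in addition, `H¹(K, E[p^∞]) → H¹(K_∞, E[p^∞])` is injective (e.g. `E(K_∞)[p^∞] = 0`).
[cite: GreenbergLNM1716, §3 p. 90 (Thm. 1.2 from Lemmas 3.1, 3.2, 3.5)] [cite: JetchevSkinnerWan2017, §3.3 (control; shape only)] -/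
theorem controlMap_bijective_of_local_descent {γ : absoluteGaloisGroup K} (hγ : κ.IsTopGenerator γ)
    (hinj : Function.Injective (ResKernel.resSubgroup κ.kerSubgroup (W.geomPrimaryTorsion p)))
    (h0 : FixedPoints.addSubgroup ↥(decomp 𝔭 ⊓ κ.kerSubgroup) (W.geomPrimaryTorsion p) = ⊥)
    (hS : ∀ c : W.subgroupH1 p (⊤ : Subgroup (absoluteGaloisGroup K)),
      W.resOfLe p (le_top : κ.kerSubgroup ≤ ⊤) c ∈ selmerAc W p κ 𝔭 S →
        ∀ v : HeightOneSpectrum (𝓞 K), ((p : ℕ) : 𝓞 K) ∉ v.asIdeal → v ∉ S →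
          c ∈ awayKer ⊤ (W.geomPrimaryTorsion p) v)
    (hinf : ∀ c : W.subgroupH1 p (⊤ : Subgroup (absoluteGaloisGroup K)),
      W.resOfLe p (le_top : κ.kerSubgroup ≤ ⊤) c ∈ selmerAc W p κ 𝔭 S →
        ∀ w : InfinitePlace K, c ∈ infKer ⊤ (W.geomPrimaryTorsion p) w) :
    Function.Bijective (controlMap W p κ 𝔭 S γ) :=
  ⟨controlMap_injective_of γ hinj,
    controlMap_surjective_of_local_descent p κ W 𝔭 S hγ h0 hS hinf⟩

end Control

end Summit.BirchSwinnertonDyer.Rank1Residual.X11b.AcSelmer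

/-! ## Route R1 -/

namespace Summit.BirchSwinnertonDyer.Rank1Residual.X11b

section RouteR1

open AcSelmer Literature.NumberTheory.EllipticCurves.Rank1Residual

variable {W : WeierstrassCurve ℚ} [W.IsElliptic] [W.IsGloballyMinimal] {p : ℕ} [Fact p.Prime]

/-- **Control for route R1 modulo the local kernels away from `p`.** On route R1's population
(`ChainLocus`), for EVERY number field `K` with `[K : ℚ] = 2`, EVERY degree-one prime `𝔭 ∣ p`, EVERY
`ℤ_p`-extension `κ` of `K` with topological generator `γ`, every `Σ`: the control map
`s : Sel_𝔭^Σ(K, E[p^∞]) → Sel_𝔭^Σ(K_∞, E[p^∞])^γ` is BIJECTIVE as soon as the away conditions at the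
finite `v ∉ Σ`, `v ∤ p` and the infinite conditions descend from `K_∞` to `K`. Injectivity:
`Irr ∧ Ram` (gens 8–10); the strict place: hypothesis (iv) (gen 10); the lift: Lemma 3.2 (tree). The
remaining inputs are exactly Greenberg's local kernels `ker r_v` at `v ∤ p` (Lemma 3.3; Castella's
`Σ ⊇ {w ∣ N⁺}` and (5.2)) and at `∞`. [cite: JetchevSkinnerWan2017, §3.3 and Thm. 3.3.1 (shape only)] [cite: Castella2018, Thm. 2.3 (arXiv:1704.06608 p. 5)] [cite: GreenbergLNM1716, §3 pp. 85–90] -/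
theorem ChainLocus.controlMap_bijective_of_local_descent (h : ChainLocus W p)
    (K : Type) [Field K] [NumberField K] (hK : Module.finrank ℚ K = 2) (κ : ZpExtension K p)
    {γ : absoluteGaloisGroup K} (hγ : κ.IsTopGenerator γ) (𝔭 : HeightOneSpectrum (𝓞 K))
    (h𝔭 : ((p : ℕ) : 𝓞 K) ∈ 𝔭.asIdeal) (he : 𝔭.asIdeal.ramificationIdx (𝓞 ℚ) = 1)
    (hf : 𝔭.asIdeal.inertiaDeg (𝓞 ℚ) = 1) (S : Set (HeightOneSpectrum (𝓞 K)))
    (hS : ∀ c : (W.baseChange K).subgroupH1 p (⊤ : Subgroup (absoluteGaloisGroup K)),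
      (W.baseChange K).resOfLe p (le_top : κ.kerSubgroup ≤ ⊤) c ∈ selmerAc (W.baseChange K) p κ 𝔭 S →
        ∀ v : HeightOneSpectrum (𝓞 K), ((p : ℕ) : 𝓞 K) ∉ v.asIdeal → v ∉ S →
          c ∈ awayKer ⊤ ((W.baseChange K).geomPrimaryTorsion p) v)
    (hinf : ∀ c : (W.baseChange K).subgroupH1 p (⊤ : Subgroup (absoluteGaloisGroup K)),
      (W.baseChange K).resOfLe p (le_top : κ.kerSubgroup ≤ ⊤) c ∈ selmerAc (W.baseChange K) p κ 𝔭 S →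
        ∀ w : InfinitePlace K, c ∈ infKer ⊤ ((W.baseChange K).geomPrimaryTorsion p) w) :
    Function.Bijective (controlMap (W.baseChange K) p κ 𝔭 S γ) :=
  AcSelmer.controlMap_bijective_of_local_descent p κ (W.baseChange K) 𝔭 S hγ
    (h.resSubgroup_kerSubgroup_injective K hK κ)
    (h.fixedPoints_decomp_inf_kerSubgroup_eq_bot K κ 𝔭 h𝔭 he hf) hS hinf

end RouteR1

end Summit.BirchSwinnertonDyer.Rank1Residual.X11b

end
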